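import Mathlib
import HarnessLib
import Summits.CriticalPhenomena.CardyFormulaZ2.Theses.CardySelfRefinement
import Summits.CriticalPhenomena.CardyFormulaZ2.Theorems.CardyRotToConfR2SymmetryUpgradeLocalityPinsSix
import Literature.Probability.RandomPlanarGeometry.SLELawOneDomainReduction
import Literature.Probability.RandomPlanarGeometry.SLETwoPointItoProofs
import Literature.Probability.RandomPlanarGeometry.ChordalReversibility
import Literature.Probability.RandomPlanarGeometry.ConformalRectangle
import Literature.Probability.RandomPlanarGeometry.IsometryCovariance

/-!
# Crux `SymmetryUpgradeR` (stmt-CriticalPhenomena-17239), line `SketchIdeatorTwo` — helper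
# `exitRigidity_of_typedSchrammPrinciple` for stub `stub_exitRigidity` (FL4, "the pin")

**Structural reduction of the pin S4 to the predecessor crux's open core.** The registered stub
`stub_exitRigidity` (conformal covariance + achirality + reversibility + typed local Markov bundle +
non-tracing + flat-wall touch exponent `1/3` ⇒ Cardy's hitting formula on conformal rectangles)
FOLLOWS from the one-domain typed Schramm principle `stub_typedSchrammPrincipleOne` of line
`isotropy-kills-beltrami` of crux `CardyRotToConfR2SymmetryUpgrade` (stmt-CriticalPhenomena-0698):
"a typed local Markov chordal family which is non-tracing and conformally covariant is, in
`(𝔻; 1, −1)`, the chordal SLE_κ law for some `κ > 0`". Indeed conformal covariance transports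
the identification to every Dobrushin domain
(`ChordalFamily.IsConformallyCovariant.isSLELaw_of_isSLELaw`, Lawler 2005 §6.1), target
independence pins `κ = 6` (`stub_localityPinsSix`, landed: LSW 2001 §3 / Werner 2007 Prop. 3.4 in
family form), and chordal SLE₆ satisfies Cardy's formula on every conformal rectangle
(`sle_six_measureReal_hitsBefore_holds`, Lawler 2005 Prop. 6.33 / Werner 2007 §3).

Consequently, along this route the touch-exponent hypothesis (S3 of the line), isometry
covariance (S6) and reversibility (S2) are NOT used by S4: the pin is at most as hard as the
typed Schramm principle on one domain, whose known obstruction (the typed `IsMarkovExtension.domain`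
clause pins the Markov kernel only at JORDAN remaining sets, `Negative.kernel_eq_of_jordan_remaining`)
is therefore the common open core of both cruxes.

References: O. Schramm, Israel J. Math. 118 (2000) §1; G. Lawler, O. Schramm, W. Werner, Acta
Math. 187 (2001) §3; W. Werner, *Lectures on two-dimensional critical percolation* (2007) §3,
Prop. 3.4; G. F. Lawler, *Conformally Invariant Processes in the Plane* (2005) §6.1, Prop. 6.33.
-/

noncomputable section

namespace Summit.CriticalPhenomena.CardyFormulaZ2.Theorems.SymmetryUpgradeR.SwallowingSkeleton

open MeasureTheory Filter Set
open Literature.Probability.RandomPlanarGeometry Literature.Probability.LatticeModels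
open Literature.Probability.Percolation hiding cardyFunction
open UpperHalfPlane (upperHalfPlaneSet)

/-- **SLE_κ for some `κ` + target independence ⇒ Cardy on rectangles** (the two landed back-end
facts: `stub_localityPinsSix` pins `κ = 6`, `sle_six_measureReal_hitsBefore_holds` is Cardy's
formula for chordal SLE₆). -/
theorem cardyOnRectangles_of_isSLELaw (P : ChordalFamily) (κ : NNReal) (hκ : 0 < κ)
    (hsle : ∀ D : DobrushinDomain, IsSLELaw κ D (P D)) (hloc : P.IsLocal)
    (hTI : P.IsTargetIndependent) :
    ∀ (R : ConformalRectangle) (φ : ConformalEquiv upperHalfPlaneSet R.carrier) (x : Fin 4 → ℝ),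
      R.IsUniformizing φ x →
        (P (R.chord 0 2 (by decide))).real (CurveClass.hitsBefore (R.arc 2) (R.arc 1)) =
          Literature.Probability.RandomPlanarGeometry.cardyFunction (crossRatio x) := by
  obtain rfl : κ = 6 :=
    CardyRotToConfR2SymmetryUpgrade.IsotropyKillsBeltrami.stub_localityPinsSix κ P hκ hsle hloc hTI
  exact fun R _ _ hφ => sle_six_measureReal_hitsBefore_holds R (hsle _) hφ

/-- Registered helper `exitRigidity_of_typedSchrammPrinciple` (for stub `stub_exitRigidity`, line
`SketchIdeatorTwo` of crux stmt-CriticalPhenomena-17239). **The pin S4 follows from the typed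
Schramm principle on one domain** (statement of `stub_typedSchrammPrincipleOne` of crux
stmt-CriticalPhenomena-0698, taken as the hypothesis; the conclusion is VERBATIM the registered
stub `stub_exitRigidity`). Proof: one-domain reduction by conformal covariance
(`IsConformallyCovariant.isSLELaw_of_isSLELaw`), `κ = 6` by target independence
(`stub_localityPinsSix`), Cardy for SLE₆ (`sle_six_measureReal_hitsBefore_holds`); the touch
exponent, isometry covariance and reversibility hypotheses are not used. -/
theorem exitRigidity_of_typedSchrammPrinciple : (∀ Q : ChordalFamily, IsLocalMarkovChordalFamily Q → (∀ D : DobrushinDomain, ∀ᵐ γ ∂(Q D), ∀ c : Curve ℂ, CurveClass.mk c = γ → ∀ s t : unitInterval, s < t → c '' Set.Icc s t ⊆ frontier D.carrier → (c '' Set.Icc s t).Subsingleton) → Q.IsConformallyCovariant → ∃ κ : NNReal, 0 < κ ∧ IsSLELaw κ DobrushinDomain.unitDisc (Q DobrushinDomain.unitDisc)) → ∀ P : ChordalFamily, IsLocalMarkovChordalFamily P → (∀ D : DobrushinDomain, ∀ᵐ γ ∂(P D), ∀ c : Curve ℂ, CurveClass.mk c = γ → ∀ s t : unitInterval, s < t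 → c '' Set.Icc s t ⊆ frontier D.carrier → (c '' Set.Icc s t).Subsingleton) → P.IsConformallyCovariant → P.IsIsometryCovariant → P.IsReversible → (∃ (D : DobrushinDomain) (z u : ℂ) (r : ℝ), z ∈ D.arc 1 ∧ z ≠ D.pt 0 ∧ z ≠ D.pt 1 ∧ ‖u‖ = 1 ∧ 0 < r ∧ D.carrier ∩ Metric.ball z r = {w | w ∈ Metric.ball z r ∧ 0 < ((starRingEnd ℂ) u * (w - z)).im} ∧ ∃ c C ε₀ : ℝ, 0 < c ∧ 0 < ε₀ ∧ ∀ ε ∈ Set.Ioo 0 ε₀, c * ε ^ (1 / 3 : ℝ) ≤ (P D).real {γ | ∃ w ∈ γ.range, dist w z < ε} ∧ (P D).real {γ | ∃ w ∈ γ.range, dist w z < ε} ≤ C * ε ^ (1 / 3 : ℝ)) → (∀ (R : ConformalRectangle) (φ : ConformalEquiv upperHalfPlaneSet R.carrier) (x : Fin 4 → ℝ), R.IsUniformizing φ x → (P (R.chord 0 2 (by decide))).real (CurveClass.hitsBefore (R.arc 2) (R.arc 1)) = cardyFunction (crossRatio x)) := by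
  intro hA P hP hNT hcov _ _ _ R φ x hφ
  obtain ⟨κ, hκ, hunit⟩ := hA P hP hNT hcov
  have hall : ∀ D : DobrushinDomain, IsSLELaw κ D (P D) := hcov.isSLELaw_of_isSLELaw hunit
  exact cardyOnRectangles_of_isSLELaw P κ hκ hall hP.isLocal hP.targetIndependent R φ x hφ

end Summit.CriticalPhenomena.CardyFormulaZ2.Theorems.SymmetryUpgradeR.SwallowingSkeleton
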